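import Mathlib
import Summits.Ventures.HodgeRepro.Tier4.Common.Geometry

/-!
# Tier4/Common/Tower — the congruence tower of `X`: (P) «for some choice of the Hecke translates» at SOME LEVEL

Blind re-derivation cell `pub-hodge-repro`, Tier 4 (README §9–§10), seat t4-typer-1 (gen 0).  Target tree path
`lean/Summits/Ventures/HodgeRepro/Tier4/Common/Tower.lean`.  Imports `Tier4/Common/Geometry.lean`
(`FormAlgebra`, `HeckeAction`, `Witness`, `Witness.P`).

WHY.  `Forms.lean` / `Geometry.lean` type ONE compact cover: `FormAlgebra.finiteDimensional` pins `Form` to the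
holomorphic forms of one compact quotient `X_K` and `HeckeAction.Hecke` to the correspondences acting on that space.
The sentence (P) (route/TIER3.md §1 item 3) reads «f the product of Hecke-translated Albanese maps … for some
choice of the Hecke translates»: `f` is defined on the common congruence cover `X_{K′} → X_K` on which the chosen
translates are maps, and the pairing is taken there (ROUTE.md §4 item 2: «a finite cover, like every finite-level
choice of the route»).  The faithful object is therefore the TOWER of the covers `X_K`, `K` running over the
congruence levels, each level a `Witness` of `Geometry.lean`, tied together by the pull-backs along the finite
covering maps.

WHAT IS TYPED.  `Tower Level Form` — for each level `K` the form algebra and the witness of `X_K` (the corner forms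
`alb_i^* ω_i` pulled back to `X_K`, the Hecke translates of that level); for `K′ ≤ K` (the deeper level `K′`) the
pull-back `pull h : Form K →ₗ[ℂ] Form K′` along `X_{K′} → X_K`, which is injective, functorial, preserves the Hodge
type and the wedge (pull-back is a ring homomorphism on forms), multiplies the `L²` pairing by the degree of the
cover (`∫_{X_{K′}} π^*(α ∧ ⋆β̄) = deg(π) ∫_{X_K} α ∧ ⋆β̄`), carries the corner forms of `X_K` to those of `X_{K′}`,
and carries every Hecke translate of level `K` to one of level `K′` (the correspondence lifted to the cover).

WHAT IS PROVED.  `Tower.P := ∃ K, (witness K).P` — «for some level and some choice of the Hecke translates of that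
level, `⟨f^*Ω_s, f^*Ω_{s̄}⟩ ≠ 0`»; `P_mono`: (P) at a level persists to every deeper level (the pairing scales by a
positive degree), hence `Tower.P` is equivalent to (P) holding at every sufficiently deep level along any chain.
Nothing here decides whether (P) holds at any level: that is the mathematics of the lines.

WHAT AN INTERFACE CAN AND CANNOT SAY.  Every field is a parameter; a theorem proved over these structures is a
theorem about every instantiation and exactly as strong as the listed properties.  Nothing here says anything about
the status of the Hodge conjecture for CM abelian varieties, which is NOT proved (HC_CM is NOT proved by anyone in
this repository).
-/

set_option autoImplicit false

noncomputable section

namespace Summit.Ventures.HodgeRepro.Tier4.Common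

/-- **The congruence tower of the witness `X`**: levels `K` (ordered by `K′ ≤ K` = `X_{K′}` covers `X_K`), at each
level the form algebra and the witness of `X_K`, and for `K′ ≤ K` the pull-back along `X_{K′} → X_K` with its
textbook properties (injective, functorial, Hodge type and wedge preserved, pairing multiplied by the degree,
corner forms and Hecke translates carried along). -/
structure Tower (Level : Type) [Preorder Level] (Form : Level → Type) [∀ K, AddCommGroup (Form K)]
    [∀ K, Module ℂ (Form K)] where
  /-- the form algebra of the cover `X_K` -/
  algebra : ∀ K : Level, FormAlgebra (Form K)
  /-- the witness structure of `X_K`: its corner forms and its Hecke translates -/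
  witness : ∀ K : Level, Witness (algebra K)
  /-- the pull-back of forms along the covering map `X_{K′} → X_K` (`K′ ≤ K`) -/
  pull : ∀ {K K' : Level}, K' ≤ K → (Form K →ₗ[ℂ] Form K')
  /-- the degree of the cover `X_{K′} → X_K` -/
  deg : ∀ {K K' : Level}, K' ≤ K → ℕ
  /-- the degree is positive -/
  deg_pos : ∀ {K K' : Level} (h : K' ≤ K), 0 < deg h
  /-- pull-back along the identity cover is the identity -/
  pull_refl : ∀ K : Level, pull (le_refl K) = LinearMap.id
  /-- pull-back is functorial along `X_{K″} → X_{K′} → X_K` -/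
  pull_trans : ∀ {K K' K'' : Level} (h : K' ≤ K) (h' : K'' ≤ K'),
    pull (le_trans h' h) = (pull h').comp (pull h)
  /-- pull-back is injective -/
  pull_injective : ∀ {K K' : Level} (h : K' ≤ K), Function.Injective (pull h)
  /-- pull-back preserves holomorphic `1`-forms -/
  pull_H10 : ∀ {K K' : Level} (h : K' ≤ K) (α : Form K), α ∈ (algebra K).H10 → pull h α ∈ (algebra K').H10
  /-- pull-back preserves holomorphic `2`-forms -/
  pull_H20 : ∀ {K K' : Level} (h : K' ≤ K) (α : Form K), α ∈ (algebra K).H20 → pull h α ∈ (algebra K').H20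
  /-- pull-back is compatible with the wedge: `π^*(α ∧ β) = π^*α ∧ π^*β` -/
  pull_wedge : ∀ {K K' : Level} (h : K' ≤ K) (α β : Form K),
    pull h ((algebra K).wedge α β) = (algebra K').wedge (pull h α) (pull h β)
  /-- pull-back multiplies the `L²` pairing by the degree: `⟨π^*α, π^*β⟩_{X_{K′}} = deg(π) · ⟨α, β⟩_{X_K}` -/
  pull_hodge : ∀ {K K' : Level} (h : K' ≤ K) (α β : Form K),
    (algebra K').hodge (pull h α) (pull h β) = (deg h : ℂ) * (algebra K).hodge α β
  /-- the corner forms of `X_{K′}` are the pull-backs of those of `X_K` -/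
  pull_omega : ∀ {K K' : Level} (h : K' ≤ K) (i : Fin 4), (witness K').omega i = pull h ((witness K).omega i)
  /-- every Hecke translate of level `K` lifts to a Hecke translate of level `K′`: `π^* ∘ T^* = T′^* ∘ π^*` -/
  lift_translate : ∀ {K K' : Level} (h : K' ≤ K) (T : (witness K).Hecke),
    ∃ T' : (witness K').Hecke, ∀ α : Form K, pull h ((witness K).translate T α) = (witness K').translate T' (pull h α)

namespace Tower

variable {Level : Type} [Preorder Level] {Form : Level → Type} [∀ K, AddCommGroup (Form K)]
  [∀ K, Module ℂ (Form K)] (𝒯 : Tower Level Form)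

/-- **(P) on the tower**: for some level `K` and some choice of the Hecke translates of that level,
`⟨f^*Ω_s, f^*Ω_{s̄}⟩_{L²(X_K)} ≠ 0`. -/
def P : Prop := ∃ K : Level, (𝒯.witness K).P

/-- The pull-back of the translated corner form `f^*ω_i` at level `K` is the translated corner form at level `K′`
for the lifted translates. -/
theorem pull_pullOmega {K K' : Level} (h : K' ≤ K) (γ : (𝒯.witness K).Translates)
    (γ' : (𝒯.witness K').Translates)
    (hγ : ∀ (i : Fin 4) (α : Form K),
      𝒯.pull h ((𝒯.witness K).translate (γ i) α) = (𝒯.witness K').translate (γ' i) (𝒯.pull h α))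
    (i : Fin 4) : 𝒯.pull h ((𝒯.witness K).pullOmega γ i) = (𝒯.witness K').pullOmega γ' i := by
  unfold Witness.pullOmega
  rw [hγ i, 𝒯.pull_omega h i]

/-- A choice of translates at level `K` lifts to a choice at the deeper level `K′`. -/
theorem exists_lift_translates {K K' : Level} (h : K' ≤ K) (γ : (𝒯.witness K).Translates) :
    ∃ γ' : (𝒯.witness K').Translates, ∀ (i : Fin 4) (α : Form K),
      𝒯.pull h ((𝒯.witness K).translate (γ i) α) = (𝒯.witness K').translate (γ' i) (𝒯.pull h α) := by
  have : ∀ i : Fin 4, ∃ T' : (𝒯.witness K').Hecke, ∀ α : Form K,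
      𝒯.pull h ((𝒯.witness K).translate (γ i) α) = (𝒯.witness K').translate T' (𝒯.pull h α) :=
    fun i => 𝒯.lift_translate h (γ i)
  choose γ' hγ' using this
  exact ⟨γ', hγ'⟩

/-- The Hodge pairing at level `K′` of the lifted translates is the degree times the pairing at level `K`. -/
theorem hodgePairing_lift {K K' : Level} (h : K' ≤ K) (γ : (𝒯.witness K).Translates)
    (γ' : (𝒯.witness K').Translates)
    (hγ : ∀ (i : Fin 4) (α : Form K),
      𝒯.pull h ((𝒯.witness K).translate (γ i) α) = (𝒯.witness K').translate (γ' i) (𝒯.pull h α)) :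
    (𝒯.witness K').hodgePairing γ' = (𝒯.deg h : ℂ) * (𝒯.witness K).hodgePairing γ := by
  have hS : (𝒯.witness K').pullOmegaS γ' = 𝒯.pull h ((𝒯.witness K).pullOmegaS γ) := by
    unfold Witness.pullOmegaS
    rw [𝒯.pull_wedge, 𝒯.pull_pullOmega h γ γ' hγ 0, 𝒯.pull_pullOmega h γ γ' hγ 1]
  have hSbar : (𝒯.witness K').pullOmegaSbar γ' = 𝒯.pull h ((𝒯.witness K).pullOmegaSbar γ) := by
    unfold Witness.pullOmegaSbar
    rw [𝒯.pull_wedge, 𝒯.pull_pullOmega h γ γ' hγ 2, 𝒯.pull_pullOmega h γ γ' hγ 3]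
  unfold Witness.hodgePairing
  rw [hS, hSbar, 𝒯.pull_hodge]

/-- **(P) persists to deeper levels**: if (P) holds at level `K` it holds at every level `K′ ≤ K`. -/
theorem P_mono {K K' : Level} (h : K' ≤ K) (hP : (𝒯.witness K).P) : (𝒯.witness K').P := by
  obtain ⟨γ, hγ⟩ := hP
  obtain ⟨γ', hγ'⟩ := 𝒯.exists_lift_translates h γ
  refine ⟨γ', ?_⟩
  rw [𝒯.hodgePairing_lift h γ γ' hγ']
  exact mul_ne_zero (by exact_mod_cast (𝒯.deg_pos h).ne') hγ

/-- (P) at any level gives (P) on the tower. -/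
theorem P_of_level (K : Level) (hP : (𝒯.witness K).P) : 𝒯.P := ⟨K, hP⟩

/-- On a tower with a common deeper level below any two levels, (P) on the tower is (P) at all sufficiently deep
levels: `Tower.P ↔ ∃ K, ∀ K′ ≤ K, (witness K′).P`. -/
theorem P_iff_eventually : 𝒯.P ↔ ∃ K : Level, ∀ K' : Level, K' ≤ K → (𝒯.witness K').P := by
  constructor
  · rintro ⟨K, hK⟩
    exact ⟨K, fun K' h => 𝒯.P_mono h hK⟩
  · rintro ⟨K, hK⟩
    exact ⟨K, hK K (le_refl K)⟩

end Tower

end Summit.Ventures.HodgeRepro.Tier4.Common
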